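import Summits.Parity.GeneralizedHardyLittlewood.Theses.LiouvilleShiftedTables
import Summits.Parity.GeneralizedHardyLittlewood.Theses.DicksonFibration
import Summits.Parity.GeneralizedHardyLittlewood.Theorems.LiouvilleMADEngineToGHL

/-!
# `PairsToGHL` (stmt-Parity-9389) is EXACTLY `PairsHL → DimOne`, unconditionally

Route LiouvilleShiftedTables (Parity / GeneralizedHardyLittlewood), crux item stmt-Parity-9389
`PairsToGHL := PairsHL → GeneralizedHardyLittlewood` (fixed-shift Hardy–Littlewood pairs, inlined,
imply Green–Tao's Conjecture 1.2 in all dimensions).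

Since the fibration lemma `DicksonFibration.Assembly : DimOne → GeneralizedHardyLittlewood`
(stmt-Parity-0822) is now a tree THEOREM (`DicksonFibration.Assembly_holds`, from
`leeYangFibres_fibrationLemma`), and `GeneralizedHardyLittlewood → DimOne` is the specialisation
`d = 1`, the crux is kernel-equivalent, with NO hypothesis, to

  `PairsHL → DicksonFibration.DimOne`      (`pairsToGHL_iff_pairsHL_imp_dimOne`),

i.e. to "binary Hardy–Littlewood at every fixed shift implies the one-dimensional Green–Tao
conjecture for all `t`, all slopes, shift-uniformly in `|bᵢ| ≤ L N`" — the open crux `DimOne`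
(stmt-Parity-0819, route DicksonFibration) weakened by the hypothesis `PairsHL`. (The specialisation
`GeneralizedHardyLittlewood → DimOne` is reused from `Theorems.EngineToGHL`, where the same
reduction is recorded for the sister crux `LiouvilleMAD.EngineToGHL ↔ PairsToGHL`.) In particular a
proof of `DimOne` closes this item by `pairsToGHL_of_dimOne`, and an unconditional refutation of the
item is a proof of `PairsHL` together with a refutation of `DimOne` (`not_pairsToGHL_iff`).
This records, as importable theorems keyed to stmt-Parity-9389, the line lead's verdict that every
concluding skeleton for the crux carries a stub at least as strong as `PairsHL → DimOne`.
-/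

namespace Summit.Parity.GeneralizedHardyLittlewood.Theorems.PairsToGHLReduction

open Summit.Parity.GeneralizedHardyLittlewood.Theses
open Summit.Parity.GeneralizedHardyLittlewood.Theorems.EngineToGHL (dimOne_of_generalizedHardyLittlewood)

/-- **The crux is `PairsHL → DimOne`, unconditionally.** `PairsToGHL ↔ (PairsHL → DimOne)`:
forward by specialising the conclusion to `d = 1`; backward by the PROVED fibration lemma
`DicksonFibration.Assembly_holds : DimOne → GeneralizedHardyLittlewood` (stmt-Parity-0822).
[folklore] -/
theorem pairsToGHL_iff_pairsHL_imp_dimOne :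
    LiouvilleShiftedTables.PairsToGHL ↔
      (LiouvilleShiftedTables.PairsHL → DicksonFibration.DimOne) :=
  ⟨fun h hP => dimOne_of_generalizedHardyLittlewood (h hP),
    fun h hP => DicksonFibration.Assembly_holds (h hP)⟩

/-- **`DimOne` closes the item.** A proof of the one-dimensional Green–Tao conjecture `DimOne`
(stmt-Parity-0819) proves `PairsToGHL` outright (the hypothesis `PairsHL` is not used), by the
proved fibration lemma. [folklore] -/
theorem pairsToGHL_of_dimOne (hD : DicksonFibration.DimOne) :
    LiouvilleShiftedTables.PairsToGHL :=
  fun _ => DicksonFibration.Assembly_holds hD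

/-- Under the route's own target `PairsHL` (stmt-Parity-9387) the crux IS `DimOne`. [folklore] -/
theorem pairsToGHL_iff_dimOne_of_pairsHL (hP : LiouvilleShiftedTables.PairsHL) :
    LiouvilleShiftedTables.PairsToGHL ↔ DicksonFibration.DimOne :=
  ⟨fun h => dimOne_of_generalizedHardyLittlewood (h hP), fun hD => pairsToGHL_of_dimOne hD⟩

/-- **What a refutation would be.** `¬PairsToGHL ↔ PairsHL ∧ ¬DimOne`: an unconditional disproof
of the item is a PROOF of Hardy–Littlewood pairs at every fixed shift together with a refutation of
the one-dimensional Green–Tao conjecture. [folklore] -/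
theorem not_pairsToGHL_iff :
    ¬ LiouvilleShiftedTables.PairsToGHL ↔
      (LiouvilleShiftedTables.PairsHL ∧ ¬ DicksonFibration.DimOne) := by
  rw [pairsToGHL_iff_pairsHL_imp_dimOne, Classical.not_imp]

end Summit.Parity.GeneralizedHardyLittlewood.Theorems.PairsToGHLReduction
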